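import Summits.QuantumFields.BalabanUV.T4Continuum.Spine.NE1p.DressedSmallFieldComponentInnerMuNestedTori
import Summits.QuantumFields.BalabanUV.T4Continuum.Spine.NE1p.DressedSmallFieldComponentInnerNestedToriWitness

/-!
# T⁴ programme, spine estimate NE1′ (node O3b/H2) — THE μ-TWIN OF S51 FIRES: a DECIDED applier of
# `DressedSmallFieldComponentInnerMuNestedTori.muPart_locE_le_of_coresAt_pencil_components_inner_nestedTori` on W69's two-scale datum
# (W59's centre cube `C_L` of block 0 of the FINE torus `tsys 4 (L·N′)` under the coarse unit block `X₀ N′`, N0u's ADMISSIBLE label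
# `⟨∅, ({C_L}, ∅)⟩`, N0u's letters located) READ ALONG THE SOURCE PENCIL `s ↦ 0 + s • liveTable` (`v := liveTable`, `μ₁ := 2`): the
# μ-bound `K₀(64,8)∕2 · μ₀∕(2 − μ₀)` for EVERY `0 < μ₀ < 2`, `‖sμ‖ ≤ μ₀`, `3 ≤ L`, `N′`; LIVE at every real source `0 < t ≤ 2`; and the
# LOCATED comparison with W69's table-pencil bound `K₀(64,8)` on the SAME increment: the source-pencil route is the smaller of the two
# iff `μ₀ < 4∕3`; [Balaban1988RGII] pp. 17–20 KIND, μ-extension UNPRINTED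

Cell `pub-balaban`, sub-cell `t4`, BINDER-OWNERS row NE1′ (owner lineage t4-ne1p-p1, road P1); crew seat
`b2b-balaban-t4-ne1p-formalise-leaf-01` (LEAF PROVER 01, generation 15); crew W-row W⟨next⟩ ∕ DAG N29⟨next⟩ «THE μ-TWIN OF S51 FIRES»
(INTENT + PROTOTYPE + STAGED `CLAIMS.log` 2026-08-20 l.23269; the typer gen 8 labels it; a (t5)-type non-vacuity witness of this
lineage's S-row `DressedSmallFieldComponentInnerMuNestedTori`, INTENT l.22959, p240443 ✓).  ADDITIVE — imports this lineage's S-row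
`Spine/NE1p/DressedSmallFieldComponentInnerMuNestedTori` (p240443) and this lineage's W69 `Spine/NE1p/DressedSmallFieldComponentInnerNestedToriWitness`
(p239069 ✓✓; → S51, W59 P2, the W24–W53 toy lineage) ONLY; THEOREMS ONLY (0 `def`, 0 `abbrev`, 0 `def … : Prop`, 0 cite): W69's toy
DATA (`GI`, `actI`, `termsI`, `εI`) and its discharged binders (`hadm_I`, `hAmp_I`, `h229k_I`, `hκk_I`, `hκR_I`, `hrate2_I`, `h229_I`),
its closed forms (`actI_real_sub_zero`, `norm_actI_X₀_lt_one`, `componentInnerNestedToriEnd_fires_closed`), W59's located numerals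
(`rN`, `RN`, `vN`, `R₀N`, `εN`, `hκ_N_eq`, `hRR_N_eq`, `hsmall_N`), W33's cores ∕ room (`ctr0`, `hroom0`, `liveTable`, `Acst`, `incr`,
`integral_incr_pos`), W35's `cM`, W45's `α₆F` and W24's `X₀`∕`hrate_torus_num`∕`exp_locE_cube` are used BY NAME — nothing restated.

WHY THIS FILE.  The S-row `DressedSmallFieldComponentInnerMuNestedTori` §2 is a FACE with S51's long hypothesis list under N0x P2's
source-pencil swap (`v`∕`μ₁`∕`μ₀`∕`sμ`∕`A`∕`hA`∕`h0`∕`h01`∕`hμ` for `w`∕`ϱ`∕`A₀`∕`A₁`∕`hA₀`∕`hA₁`∕`hϱ`∕`hϱA`); a referee asks of every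
END shape whether it is JOINTLY SATISFIABLE non-trivially ((t5)).  W69 answered that for S51 along the TABLE pencil `h₀ + σ • w`,
`‖σ‖ < ϱ = 2`.  The SAME datum answers it for the μ-twin with NO new data: W69's activity `actI k s Z = Σ_{l ∈ termsI Z} (GI k l k).termAt 0
(0 + s • liveTable)` IS a source pencil once `liveTable` is read as the direction `v` and `2` as the source radius `μ₁` — `hact` by `rfl`,
`hH` by `‖liveTable‖ ≤ 1`, `hAmp` = W69's `hAmp_I` VERBATIM at `A := 0 + 2·(A_cst∕4)` (the number W69 charges as `A₀ + ϱ·A₁`), `hsmall`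
= W59's `hsmall_N` VERBATIM, every other binder W69's BY NAME.
* §1 **`componentInnerMuNestedToriEnd_fires`** — the S-row's §2 END ONCE BY NAME; closed form **`…_fires_closed`**:
  `‖E[act sμ](X₀) − E[act 0](X₀)‖ ≤ K₀(64,8)∕2 · μ₀∕(2 − μ₀)` (`e·9·64·K₀²·(A_cst∕2) = K₀∕2` since `A_cst = (e·K₀·9·64)⁻¹`).
* §2 LIVE — **`actI_real_live`** (`E`-free: the activity at a real source `t > 0` differs from the one at `0`: W41's closed form ×
  W33's `∫ incr (t·r) > 0`), **`componentInnerMuNestedToriEnd_live`** (the dressed outputs on the unit block differ, by W24's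
  `exp_locE_cube`, for `0 < t ≤ 2`).
* §3 THE LOCATED COMPARISON [arith] — on the SAME increment `E[act 1](X₀) − E[act 0](X₀)` W69's table-pencil bound is `K₀(64,8)`
  (`componentInnerNestedToriEnd_fires_closed`) and §1's source-pencil bound at `μ₀ = 1` is `K₀(64,8)∕2`: **`both_routes_at_unit_source`**;
  in general `K₀∕2·μ₀∕(2 − μ₀) < K₀ ↔ μ₀ < 4∕3` (**`muBound_lt_tableBound_iff`**) — the Schwarz-lemma route (N0s's `μ₀∕(μ₁ − μ₀)`) is the
  smaller one exactly on the inner two thirds of the source disc; closing decided `example` at `L = 3`, `t = 1`.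
WHAT STAYS DISPLAYED ∕ HONEST FRAMING.  A DECIDED TOY over hypothesis SHAPES: the cores are W33's one-dimensional Gaussian cores, NOT
Bałaban's (2.14) densities; (B1b) is MET BY CONSTRUCTION on the toy (W69's `hadm_I`), NOT claimed for Bałaban's expansion; (B3-amp)
`hAmp` is met BY CHOICE of the Cauchy weights — UNPRINTED for Bałaban's cores (G-ne9p2-5); the μ-extension (observable-attached table,
source pencil) is the cell's, UNPRINTED ([Balaban1989LargeFieldII] p. 356 defers observables); the located numerals are pv22's ∕ the
crew's PROVED constants; print's ½L, (L+2)⁴, (2.32)'s 4, «L > 11 odd» are TYPE∕CONTEXT only; no numeral of [Balaban1988RGII] is used;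
§3 compares two of OUR bounds on OUR toy — it says NOTHING about which route is sharper on Bałaban's densities.  0 binders instantiated
on Bałaban's densities; no wall item; wall v1.8 (T4-DAG v48) — words, not kind — does NOT move; R-t4r2-Q2 NOT met; NE1′ ⇐ the named
binders — ONE label NEW ∕ NOT PRINTED ∕ NOT PROVED; spine PROVED 0∕9; count 9 unchanged.  ABSOLUTE RULE honoured (nothing internally
minted is cited; [folklore]∕[arith] tags on kernel facts only).  Rung (B)+1 on ONE finite four-torus — NOT infinite volume, NOT a mass
gap, NOT OS on ℝ⁴, NOT Clay.  HONEST DEPENDENCY: continuum YM on T⁴ ⇐ BetaPertH ∧ nine spine estimates (0/9 proved); BetaPertH ⇐ (D1)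
∧ (D4) ∧ CAP+tail; G-an2-4 gates asym, D1 and NE2/3/4.
-/

noncomputable section

namespace Summit.QuantumFields.BalabanUV.T4Continuum.NE1p.DressedSmallFieldComponentInnerMuNestedToriWitness

open Set Metric MeasureTheory Complex
open scoped BigOperators
open Literature.MathematicalPhysics.QuantumFieldTheory.Balaban1983to89
open Literature.MathematicalPhysics.QuantumFieldTheory.Balaban1983to89.B12TreeDecay (K₀ K₀_pos)
open Literature.MathematicalPhysics.QuantumFieldTheory.Balaban1983to89.B13Resummation (locE)
open Literature.MathematicalPhysics.QuantumFieldTheory.Balaban1983to89.TreeLengthTorus (TPt TDom tsys torusTreeLen)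
open Literature.MathematicalPhysics.QuantumFieldTheory.Balaban1983to89.TreeLengthTorusGeometry (tgeometry TTouch)
open Summit.QuantumFields.BalabanUV.T4Continuum.B13HistMeasurable (B13HistM)
open Summit.QuantumFields.BalabanUV.T4Continuum.B13HistWitness (toyFrame)
open Summit.QuantumFields.BalabanUV.T4Continuum.B13TermParamGaussianBi (BiCore)
open Summit.QuantumFields.BalabanUV.T4Continuum.NE1p.DressedSmallFieldTorusWitness (X₀ X₀_val hrate_torus_num exp_locE_cube)
open Summit.QuantumFields.BalabanUV.T4Continuum.NE1p.DressedSmallFieldCoresWitness (E1 liveTable norm_liveTable_le ctr0 hroom0 Acst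
  Acst_pos incr integral_incr_pos)
open Summit.QuantumFields.BalabanUV.T4Continuum.NE1p.DressedSmallFieldCoresMassWitness (cM cM_pos)
open Summit.QuantumFields.BalabanUV.T4Continuum.NE1p.DressedSmallFieldFamiliesWitness (α₆F α₆F_pos)
open Summit.QuantumFields.BalabanUV.T4Continuum.NE1p.DressedSmallFieldNestedToriWitness (rN RN vN R₀N εN vN_pos εN_pos hκ_N_eq
  hRR_N_eq hsmall_N)
open Summit.QuantumFields.BalabanUV.T4Continuum.NE1p.DressedSmallFieldComponentInnerNestedToriWitness (εI εI_pos h229k_I hκk_I hκR_I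
  hrate2_I h229_I termsI GI GI_apply actI hadm_I hAmp_I actI_real_sub_zero norm_actI_X₀_lt_one componentInnerNestedToriEnd_fires_closed)
open Summit.QuantumFields.BalabanUV.T4Continuum.NE1p.DressedSmallFieldComponentInnerMuNestedTori
  (muPart_locE_le_of_coresAt_pencil_components_inner_nestedTori)

variable (L N' : ℕ) [NeZero L] [NeZero N'] (r : ℝ) (hr : 0 ≤ r)

/-! ## §1 THE μ-TWIN FIRES: the S-row's §2 END applied ONCE BY NAME on W69's datum read along the source pencil -/

open Classical in
/-- **`muPart_locE_le_of_coresAt_pencil_components_inner_nestedTori` FIRES** [decided toy]: the coarse torus `tsys 4 N′`, the FINE torus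
`tsys 4 (L·N′)`, W69's cores `GI` indexed by its two labels, W33's `ctr0`∕`hroom0`, NE5's toy letters INLINE, the source pencil
`v := liveTable`, `μ₁ := 2` (`hH` by `‖liveTable‖ ≤ 1`), `hscale`∕`hact` by `rfl`, W24's `hrate_torus_num`, W59's `hsmall_N` at
`A := 0 + 2·(A_cst∕4)`; N0u's letters `bondsOf := ∅`, `(δ, κ, α₆, R_k, b₀, s, t) := (1, rN, α₆F, R₀N L, 0, 0, 0)` with W69 §1's clauses;
`(ε, r, R, vW) := (εI, rN, RN, vN)` with W69's `h229_I` and W59's `hRR_N_eq`; W69's `hadm_I`, `hAmp_I` VERBATIM.  For every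
`0 < μ₀ < 2` and `‖sμ‖ ≤ μ₀`; conclusion LITERAL (the crew's coarse-torus μ-currency at `r₁ = 0`). [folklore] -/
theorem componentInnerMuNestedToriEnd_fires (hL : 3 ≤ L) (k : ℕ) {μ₀ : ℝ} {sμ : ℂ} (h0 : 0 < μ₀) (h01 : μ₀ < 2)
    (hμ : ‖sμ‖ ≤ μ₀) :
    ‖locE (TTouch (d := 4) (N := N')) (fun Z : (tsys 4 N').Dom => Z.1) (actI L N' r hr k sμ) (X₀ N').1 -
        locE (TTouch (d := 4) (N := N')) (fun Z : (tsys 4 N').Dom => Z.1) (actI L N' r hr k 0) (X₀ N').1‖ ≤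
      Real.exp 1 * 9 * 64 * K₀ 64 8 ^ 2 * (0 + 2 * (Acst / 4)) * Real.exp (-(0 * torusTreeLen (X₀ N').1)) *
        (μ₀ / (2 - μ₀)) :=
  muPart_locE_le_of_coresAt_pencil_components_inner_nestedTori hL (GI L N' r hr)
    (Win := Set.univ) (ctr := ctr0) (ROp := fun _ => 1) (RHist := fun _ => 2) (R' := fun _ => 2)
    (mq := fun _ _ _ => 1) (bq := fun _ _ _ => 0) (N₀ := fun _ _ _ => 1)
    hroom0 (fun _ _ _ _ _ _ _ => one_pos)
    (fun _ _ _ _ _ _ _ => ⟨fun _ _ => aestronglyMeasurable_const, fun _ => differentiableOn_const _, fun _ _ _ => by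
      show ‖(1 : ℂ)‖ ≤ 1; rw [norm_one]⟩)
    (fun _ _ _ _ _ _ _ => ⟨fun _ _ => (Complex.measurable_ofReal.comp (measurable_snd.norm.pow_const 2)).aestronglyMeasurable,
      fun _ _ => differentiableOn_const _, fun _ _ _ v => by
        show 1 * ‖v‖ ^ 2 - 0 ≤ (((‖v‖ ^ 2 : ℝ) : ℂ)).re; rw [Complex.ofReal_re]; simp⟩)
    (g := fun _ => 0) (Set.mem_univ _) (U := ()) (o := 0) (h₀ := 0) (v := liveTable) (μ₁ := 2)
    (by show ‖(0 : ℂ) - 0‖ ≤ 1; simp)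
    (by show ‖(0 : B13HistM toyFrame) - 0‖ + 2 * ‖liveTable‖ ≤ 2; rw [sub_zero, norm_zero, zero_add];
        linarith [norm_liveTable_le])
    (emb := fun _ => k) (fun _ => rfl) (terms := termsI L N') (act := actI L N' r hr k) (fun _ _ _ => rfl)
    (A := 0 + 2 * (Acst / 4)) (r₁ := 0) (X₀ N') (sμ := sμ)
    (by have := Acst_pos; positivity) le_rfl hrate_torus_num hsmall_N
    (fun _ => (∅ : Finset Unit)) (δ := 1) (κ := rN) (α₆ := α₆F) (Rk := R₀N L) (b₀ := 0) (s := 0) (t := 0)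
    α₆F_pos.le (hκk_I) h229k_I le_rfl zero_le_one le_rfl (fun W => by simp)
    (ε := εI L) (r := rN) (R := RN) (vW := vN) (εI_pos L).le vN_pos.le
    (hκR_I L hL) (hrate2_I L hL) hκ_N_eq.le (h229_I L) hRR_N_eq.le (hadm_I L N' hL) (hAmp_I L N' r hr k) h0 h01 hμ

open Classical in
/-- … in CLOSED FORM: `≤ K₀(64,8)∕2 · μ₀∕(2 − μ₀)` (`e·9·64·K₀²·(A_cst∕2) = K₀∕2`). [folklore] -/
theorem componentInnerMuNestedToriEnd_fires_closed (hL : 3 ≤ L) (k : ℕ) {μ₀ : ℝ} {sμ : ℂ} (h0 : 0 < μ₀) (h01 : μ₀ < 2)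
    (hμ : ‖sμ‖ ≤ μ₀) :
    ‖locE (TTouch (d := 4) (N := N')) (fun Z : (tsys 4 N').Dom => Z.1) (actI L N' r hr k sμ) (X₀ N').1 -
        locE (TTouch (d := 4) (N := N')) (fun Z : (tsys 4 N').Dom => Z.1) (actI L N' r hr k 0) (X₀ N').1‖ ≤
      K₀ 64 8 / 2 * (μ₀ / (2 - μ₀)) := by
  refine (componentInnerMuNestedToriEnd_fires L N' r hr hL k h0 h01 hμ).trans (le_of_eq ?_)
  rw [zero_mul, neg_zero, Real.exp_zero, mul_one]
  unfold Acst
  have hK := K₀_pos (64 : ℝ) 8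
  have he := Real.exp_pos 1
  field_simp
  ring

/-! ## §2 LIVE: the μ-part of the activity, and of the dressed output on the unit block, is NOT zero at any real source `0 < t ≤ 2` -/

/-- **THE μ-PART OF THE ACTIVITY IS NOT ZERO** at a real source `t > 0` (`(cM r∕2)(εN·α₆F + v) > 0`, W33's `∫ incr (t·r) > 0`). [folklore] -/
theorem actI_real_live (hr0 : 0 < r) (k : ℕ) {t : ℝ} (ht : 0 < t) :
    actI L N' r hr k (t : ℂ) (X₀ N') ≠ actI L N' r hr k 0 (X₀ N') := by
  intro h
  have h0 := sub_eq_zero.2 h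
  rw [actI_real_sub_zero] at h0
  have hc : 0 < cM r / 2 * (εN L * α₆F + vN) :=
    mul_pos (half_pos (cM_pos r)) (by have := mul_pos (εN_pos L) α₆F_pos; linarith [vN_pos])
  rcases mul_eq_zero.1 h0 with hc0 | hI
  · exact hc.ne' (by exact_mod_cast hc0)
  · exact (integral_incr_pos (t * r) (mul_pos ht hr0)).ne' (by exact_mod_cast hI)

open Classical in
/-- **THE END's BOUNDED μ-QUANTITY IS NOT ZERO** [decided toy]: equal dressed outputs on the coarse unit block at the sources `t` and `0`
would give equal activities at `X₀` (W24's `exp_locE_cube` BY NAME — both activities lie in the unit disc for `t ≤ 2`), contradicting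
`actI_real_live`. [folklore] -/
theorem componentInnerMuNestedToriEnd_live (hr0 : 0 < r) (k : ℕ) {t : ℝ} (ht : 0 < t) (ht2 : t ≤ 2) :
    locE (TTouch (d := 4) (N := N')) (fun Z : (tsys 4 N').Dom => Z.1) (actI L N' r hr k t) (X₀ N').1 ≠
      locE (TTouch (d := 4) (N := N')) (fun Z : (tsys 4 N').Dom => Z.1) (actI L N' r hr k 0) (X₀ N').1 := by
  intro h
  have hn : ‖((t : ℝ) : ℂ)‖ ≤ 2 := by rw [Complex.norm_real, Real.norm_eq_abs, abs_of_pos ht]; exact ht2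
  have h1 := exp_locE_cube N' (w := actI L N' r hr k t) (norm_actI_X₀_lt_one L N' r hr k hn)
  have h0 := exp_locE_cube N' (w := actI L N' r hr k 0) (norm_actI_X₀_lt_one L N' r hr k (by simp))
  have h' : cexp (locE (TTouch (d := 4) (N := N')) (fun Z : (tsys 4 N').Dom => Z.1) (actI L N' r hr k t) {0}) =
      cexp (locE (TTouch (d := 4) (N := N')) (fun Z : (tsys 4 N').Dom => Z.1) (actI L N' r hr k 0) {0}) := congrArg cexp h
  rw [h1, h0, add_right_inj] at h'
  exact actI_real_live L N' r hr hr0 k ht h'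

/-! ## §3 THE LOCATED COMPARISON of the two routes on the SAME increment `E[act 1](X₀) − E[act 0](X₀)` [arith] -/

open Classical in
/-- **BOTH ROUTES AT THE UNIT SOURCE** [decided toy]: W69's table-pencil bound (S51, `ϱ = 2`, `A₀ = 0`, `A₁ = A_cst∕4`) gives `K₀(64,8)`
and §1's source-pencil bound at `μ₀ = 1` gives `K₀(64,8)∕2` for the same norm. [folklore] -/
theorem both_routes_at_unit_source (hL : 3 ≤ L) (k : ℕ) :
    ‖locE (TTouch (d := 4) (N := N')) (fun Z : (tsys 4 N').Dom => Z.1) (actI L N' r hr k 1) (X₀ N').1 -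
          locE (TTouch (d := 4) (N := N')) (fun Z : (tsys 4 N').Dom => Z.1) (actI L N' r hr k 0) (X₀ N').1‖ ≤ K₀ 64 8 ∧
      ‖locE (TTouch (d := 4) (N := N')) (fun Z : (tsys 4 N').Dom => Z.1) (actI L N' r hr k 1) (X₀ N').1 -
          locE (TTouch (d := 4) (N := N')) (fun Z : (tsys 4 N').Dom => Z.1) (actI L N' r hr k 0) (X₀ N').1‖ ≤ K₀ 64 8 / 2 := by
  refine ⟨componentInnerNestedToriEnd_fires_closed L N' r hr hL k, ?_⟩
  have h := componentInnerMuNestedToriEnd_fires_closed L N' r hr hL k (μ₀ := 1) (sμ := 1) one_pos (by norm_num) (by simp)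
  norm_num at h
  exact h

/-- **WHICH ROUTE IS SMALLER** [arith]: `K₀∕2 · μ₀∕(2 − μ₀) < K₀ ↔ μ₀ < 4∕3` for `μ₀ < 2` — N0s's Schwarz factor `μ₀∕(μ₁ − μ₀)` at
`μ₁ = 2` beats the table route's constant exactly on the inner two thirds of the source disc (a statement about OUR two bounds on OUR
toy, nothing about Bałaban's densities). [folklore] -/
theorem muBound_lt_tableBound_iff {μ₀ : ℝ} (h2 : μ₀ < 2) :
    K₀ 64 8 / 2 * (μ₀ / (2 - μ₀)) < K₀ 64 8 ↔ μ₀ < 4 / 3 := by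
  have hK := K₀_pos (64 : ℝ) 8
  have hd : 0 < 2 - μ₀ := by linarith
  rw [div_mul_div_comm, div_lt_iff₀ (by positivity)]
  constructor
  · intro h
    nlinarith [hK]
  · intro h
    nlinarith [hK, mul_pos hK (show (0 : ℝ) < 4 / 3 - μ₀ by linarith)]

open Classical in
/-- **THE μ-TWIN FIRES ON A LIVE TWO-SCALE DATUM WITH N0u's LABEL** at pv22's least blocking factor `L = 3`, unit source `t = 1`:
liveness ∧ the μ-bound `K₀(64,8)∕2` on every coarse torus `N′`. [folklore] -/
example (hr0 : 0 < r) (k : ℕ) :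
    locE (TTouch (d := 4) (N := N')) (fun Z : (tsys 4 N').Dom => Z.1) (actI 3 N' r hr k 1) (X₀ N').1 ≠
        locE (TTouch (d := 4) (N := N')) (fun Z : (tsys 4 N').Dom => Z.1) (actI 3 N' r hr k 0) (X₀ N').1 ∧
      ‖locE (TTouch (d := 4) (N := N')) (fun Z : (tsys 4 N').Dom => Z.1) (actI 3 N' r hr k 1) (X₀ N').1 -
          locE (TTouch (d := 4) (N := N')) (fun Z : (tsys 4 N').Dom => Z.1) (actI 3 N' r hr k 0) (X₀ N').1‖ ≤ K₀ 64 8 / 2 := by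
  refine ⟨?_, (both_routes_at_unit_source 3 N' r hr (by norm_num) k).2⟩
  have h := componentInnerMuNestedToriEnd_live 3 N' r hr hr0 k (t := 1) one_pos (by norm_num)
  rwa [Complex.ofReal_one] at h

end Summit.QuantumFields.BalabanUV.T4Continuum.NE1p.DressedSmallFieldComponentInnerMuNestedToriWitness

end
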